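import Summits.ResolutionOfSingularities.ResolutionOfSingularities.Theorems.WeightedInvariantIotaOrderStratDimTwo
import HarnessLib

/-!
# Monomial-type bookkeeping for the order function: `f = v·gⁿ` under localization and along a stratum
# — door `HypersurfaceCentreConstruction` (stmt-ResolutionOfSingularities-19897), rung P2 (ORDER (o24) of res-L1-w43-plan-1)

[OURS · L1 W4.3 · cell `res-hironaka`, HUMAN RULING D-0089] Helper file `--supports stmt-ResolutionOfSingularities-19897`;
own-thread ι/ord-API after-care of `Theorems/WeightedInvariantIotaOrderStratDimTwo.lean` (p509553) for the (o24-·) hands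
((o24-G) res-type-098, (o24-O) res-type-005/025, (o24-C) res-type-078, (o24-D) res-type-092/070). Typer res-type-073
(gen 10). AI-produced, weaker than expert review. NOT a statement of the manuscript under review (Hironaka 2017,
[claim: Hironaka2017, status: under-review]); nothing here is attributed to its author; nothing here is a claim about
resolution of singularities. No definitions, `J`-free. Everything is stated with the explicit binders
`(hv : IsUnit v) (hg : g ∈ 𝔪) (hg2 : g ∉ 𝔪²) (hf : f = v * g ^ n)` — the body of `IsMonomialType f` of ORDER (o24-D) —
so that this file does not depend on the (o24-D) definitions module.

## Contents (`S`, `T` regular local rings of ANY Krull dimension)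

* `iotaOrd_localization_of_eq_unit_mul_pow` (M2, and `…_of_mem` with `f ∈ 𝔭`; `mem_of_eq_unit_mul_pow_of_mem`):
  `f = v·gⁿ`, `𝔭 ∋ g` prime ⇒ `ord_{S_𝔭}(f) = n` (`≤` by (c7) `iotaOrd_generizationMonotone`, p502169; `≥` because `f ∈ 𝔭ⁿ`).
* `algebraMap_regularParameter_not_mem_sq` (M3): a regular parameter `g ∈ 𝔪 ∖ 𝔪²` stays a regular parameter in `S_𝔭` for
  every prime `𝔭 ∋ g` — Zariski–Nagata `𝔭⁽²⁾ ⊆ 𝔪²` read through (c7).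
* `exists_eq_unit_mul_pow_localization` (M4): monomial type DESCENDS to `S_𝔭` for every prime `𝔭 ∋ g` (the (loc) clause of
  the game in case A; the «DVR → cylinder» case of (c11)↾≤2).
* `adicOrder_eq_one_of_unit_mul_pow_le` / `not_mem_sq_of_iotaOrd_le_of_eq_unit_mul_pow` (M5): in ANY regular local ring `T`,
  `F = v·Gⁿ` with `v` a unit, `G ∈ 𝔪_T`, `1 ≤ n` and `ord_T F ≤ n` force `G ∉ 𝔪_T²` (order additivity `n·ord G ≤ n`) — at a
  stratum prime `𝔮` of a model (`ord_𝔮 F = ord_𝔪 F = n` by the stratum iff) the image of `G` is a regular parameter of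
  `A_𝔮`, so `F` is of monomial type there too (presentation `(G)^m` of (open″) in case (ii)).
* `iotaOrd_eq_natCast_of_eq_unit_mul_pow` (M6): `ord_T(v·Gⁿ) = n` (= p509553 `iotaOrd_unit_mul_pow`, re-exported with the
  equation as a hypothesis for `T`-side rewriting).
* `strat_adm_maximalIdeal_of_not_exists` / `strat_adm_span_singleton_of_eq_unit_mul_pow`: p509553's (strat)+(adm)
  dichotomy re-keyed by the literal `IsMonomialType` shapes (case B: `¬ ∃ v g ν, …`, dim ≤ 2; case A: the witness, any dim).
* `exists_forall_localization_eq_unit_mul_pow` (M7): a monomial-type RELATION `F/1 = v·(G/1)ⁿ` in `A_𝔪` (`v` unit) spreads to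
  `F/1 = w·(G/1)ⁿ` (`w` unit) in `A_𝔮` for every prime `𝔮` of a basic open `D(h) ∋ 𝔪` (clearing denominators).

## References

* O. Zariski, P. Samuel, *Commutative Algebra* II, Ch. VIII §1 Thm. 1 (order valuation of a regular local ring), via the tree
  file `RegularLocalOrderValuation.lean`. [ZariskiSamuel1960]
* V. Cossart, O. Piltant, J. Algebra 320 (2008), proof of Prop. 4.2 (`ord_𝔭 ≤ ord_𝔪`), via (c7) p502169. [CossartPiltant2008]
-/

noncomputable section

set_option linter.dupNamespace false -- mandated namespace `Summit.<Summit>.<Problem>` of this single-conjunct summit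

open IsLocalRing Literature.AlgebraicGeometry.Resolution

namespace Summit.ResolutionOfSingularities.ResolutionOfSingularities.Cruxes.HypersurfaceCentreConstruction.LocalEngine

namespace IotaOrderStrat

variable {S : Type} [CommRing S]

/-! ## (M6) The order of `v·gⁿ` (re-export with the equation as a hypothesis) -/

/-- `ord_T(f) = n` for `f = v·gⁿ`, `v` a unit, `g ∈ 𝔪 ∖ 𝔪²`, in a regular local ring. [cite: ZariskiSamuel1960, Ch. VIII §1 Thm. 1] -/
theorem iotaOrd_eq_natCast_of_eq_unit_mul_pow [IsRegularLocalRing S] {v g f : S} (hv : IsUnit v)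
    (hg : g ∈ maximalIdeal S) (hg2 : g ∉ maximalIdeal S ^ 2) {n : ℕ} (hf : f = v * g ^ n) :
    iotaOrd S f = n := by
  rw [hf, iotaOrd_unit_mul_pow hv hg hg2 n]

/-! ## (M2)–(M4) Localization at a prime containing `g` -/

/-- A prime containing `f = v·gⁿ` (`v` a unit) contains `g`. [folklore] -/
theorem mem_of_eq_unit_mul_pow_of_mem {v g f : S} (hv : IsUnit v) {n : ℕ} (hf : f = v * g ^ n)
    (𝔭 : Ideal S) [𝔭.IsPrime] (hf𝔭 : f ∈ 𝔭) : g ∈ 𝔭 := by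
  rw [hf] at hf𝔭
  exact Ideal.IsPrime.mem_of_pow_mem ‹_› n ((Ideal.unit_mul_mem_iff_mem 𝔭 hv).mp hf𝔭)

/-- **(M2)** For `f = v·gⁿ` (`v` unit, `g ∈ 𝔪 ∖ 𝔪²`) and every prime `𝔭 ∋ g` of a regular local ring `S` (ANY dimension):
`ord_{S_𝔭}(f) = n` — `≤ ord_𝔪(f) = n` by (c7) and `≥ n` because `f ∈ 𝔭ⁿ`. [OURS · L1 W4.3, kernel] -/
theorem iotaOrd_localization_of_eq_unit_mul_pow [IsRegularLocalRing S] {v g f : S} (hv : IsUnit v)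
    (hg : g ∈ maximalIdeal S) (hg2 : g ∉ maximalIdeal S ^ 2) {n : ℕ} (hf : f = v * g ^ n)
    (𝔭 : Ideal S) [𝔭.IsPrime] (hg𝔭 : g ∈ 𝔭) :
    iotaOrd (Localization.AtPrime 𝔭) (algebraMap S (Localization.AtPrime 𝔭) f) = n := by
  refine le_antisymm ?_ ?_
  · rw [← iotaOrd_eq_natCast_of_eq_unit_mul_pow hv hg hg2 hf]
    exact iotaOrd_generizationMonotone S 𝔭 f
  · refine natCast_le_iotaOrd_localization_of_mem_pow 𝔭 ?_
    rw [hf]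
    exact Ideal.mul_mem_left _ _ (Ideal.pow_mem_pow hg𝔭 n)

/-- (M2, clause form) the same with the game clause's hypothesis `f ∈ 𝔭` instead of `g ∈ 𝔭`. [OURS · L1 W4.3, kernel] -/
theorem iotaOrd_localization_of_eq_unit_mul_pow_of_mem [IsRegularLocalRing S] {v g f : S} (hv : IsUnit v)
    (hg : g ∈ maximalIdeal S) (hg2 : g ∉ maximalIdeal S ^ 2) {n : ℕ} (hf : f = v * g ^ n)
    (𝔭 : Ideal S) [𝔭.IsPrime] (hf𝔭 : f ∈ 𝔭) :
    iotaOrd (Localization.AtPrime 𝔭) (algebraMap S (Localization.AtPrime 𝔭) f) = n :=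
  iotaOrd_localization_of_eq_unit_mul_pow hv hg hg2 hf 𝔭 (mem_of_eq_unit_mul_pow_of_mem hv hf 𝔭 hf𝔭)

/-- **(M3) A regular parameter stays a regular parameter at every generization containing it**: for `g ∈ 𝔪 ∖ 𝔪²` in a
regular local ring `S` and a prime `𝔭 ∋ g`, `g/1 ∉ 𝔪_{S_𝔭}²` (Zariski–Nagata `𝔭⁽²⁾ ⊆ 𝔪²`, here through (c7):
`ord_{S_𝔭}(g) ≤ ord_𝔪(g) = 1`). [cite: CossartPiltant2008, Prop. 4.2 (proof)] -/
theorem algebraMap_regularParameter_not_mem_sq [IsRegularLocalRing S] {g : S} (hg : g ∈ maximalIdeal S)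
    (hg2 : g ∉ maximalIdeal S ^ 2) (𝔭 : Ideal S) [𝔭.IsPrime] (hg𝔭 : g ∈ 𝔭) :
    algebraMap S (Localization.AtPrime 𝔭) g ∉ maximalIdeal (Localization.AtPrime 𝔭) ^ 2 := by
  intro hmem
  have h2 := (natCast_le_iotaOrd_iff (Localization.AtPrime 𝔭) (algebraMap S (Localization.AtPrime 𝔭) g) 2).mpr hmem
  have h1 : iotaOrd (Localization.AtPrime 𝔭) (algebraMap S (Localization.AtPrime 𝔭) g) = (1 : ℕ) :=
    iotaOrd_localization_of_eq_unit_mul_pow isUnit_one hg hg2 (f := g) (n := 1) (by rw [one_mul, pow_one]) 𝔭 hg𝔭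
  rw [h1] at h2
  exact absurd (by exact_mod_cast h2 : (2 : ℕ) ≤ 1) (by omega)

/-- The image of a regular parameter `g ∈ 𝔭` lies in the maximal ideal of `S_𝔭`. [folklore] -/
theorem algebraMap_mem_maximalIdeal_localization_of_mem {g : S} (𝔭 : Ideal S) [𝔭.IsPrime] (hg𝔭 : g ∈ 𝔭) :
    algebraMap S (Localization.AtPrime 𝔭) g ∈ maximalIdeal (Localization.AtPrime 𝔭) :=
  (IsLocalization.AtPrime.to_map_mem_maximal_iff (Localization.AtPrime 𝔭) 𝔭 g).mpr hg𝔭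

/-- **(M4) Monomial type descends to every generization containing `g`.** If `f = v·gⁿ` in a regular local ring `S`
(`v` unit, `g ∈ 𝔪 ∖ 𝔪²`) and `𝔭 ∋ g` is prime, then in `S_𝔭`: `f/1 = (v/1)·(g/1)ⁿ` with `v/1` a unit and `g/1` a regular
parameter of `S_𝔭`. (Feeds the (loc) clause of the game in case A and the «DVR → cylinder» case of (c11)↾≤2.)
[OURS · L1 W4.3, kernel] -/
theorem exists_eq_unit_mul_pow_localization [IsRegularLocalRing S] {v g f : S} (hv : IsUnit v)
    (hg : g ∈ maximalIdeal S) (hg2 : g ∉ maximalIdeal S ^ 2) {n : ℕ} (hf : f = v * g ^ n)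
    (𝔭 : Ideal S) [𝔭.IsPrime] (hg𝔭 : g ∈ 𝔭) :
    ∃ v' : Localization.AtPrime 𝔭, IsUnit v' ∧
      algebraMap S (Localization.AtPrime 𝔭) g ∈ maximalIdeal (Localization.AtPrime 𝔭) ∧
      algebraMap S (Localization.AtPrime 𝔭) g ∉ maximalIdeal (Localization.AtPrime 𝔭) ^ 2 ∧
      algebraMap S (Localization.AtPrime 𝔭) f = v' * (algebraMap S (Localization.AtPrime 𝔭) g) ^ n :=
  ⟨algebraMap S (Localization.AtPrime 𝔭) v, hv.map _, algebraMap_mem_maximalIdeal_localization_of_mem 𝔭 hg𝔭,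
    algebraMap_regularParameter_not_mem_sq hg hg2 𝔭 hg𝔭, by rw [hf, map_mul, map_pow]⟩

/-! ## (M5) Along a stratum: equal order forces the parameter to stay regular -/

/-- **(M5, `ℕ∞` form)** In a regular local ring `T`: if `F = v·Gⁿ` with `v` a unit, `G ∈ 𝔪_T`, `1 ≤ n`, and
`ord_T F ≤ n`, then `ord_T G = 1` (additivity: `ord F = n·ord G ≥ n`, so `n·ord G = n`). [cite: ZariskiSamuel1960, Ch. VIII §1 Thm. 1] -/
theorem adicOrder_eq_one_of_unit_mul_pow_le {T : Type} [CommRing T] [IsRegularLocalRing T] {v G F : T}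
    (hv : IsUnit v) (hG : G ∈ maximalIdeal T) {n : ℕ} (hn : 1 ≤ n) (hF : F = v * G ^ n)
    (hle : adicOrder F ≤ n) : adicOrder G = 1 := by
  have hG1 : (1 : ℕ∞) ≤ adicOrder G := by
    have := (le_adicOrder_iff G 1).mpr (by rwa [pow_one])
    exact_mod_cast this
  have hF' : adicOrder F = n * adicOrder G := by
    rw [hF, adicOrder_mul, adicOrder_pow, adicOrder_of_isUnit hv, zero_add]
  rw [hF'] at hle
  -- `adicOrder G` is finite: else `n * ⊤ = ⊤ ≤ n` is absurd
  obtain ⟨a, ha⟩ : ∃ a : ℕ, adicOrder G = a := by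
    refine Option.ne_none_iff_exists'.mp fun htop => ?_
    rw [show adicOrder G = ⊤ from htop, ENat.mul_top (by exact_mod_cast (show n ≠ 0 by omega))] at hle
    exact absurd hle (not_le.mpr (ENat.coe_lt_top n))
  rw [ha] at hle hG1 ⊢
  have hle' : n * a ≤ n := by exact_mod_cast hle
  have h1 : 1 ≤ a := by exact_mod_cast hG1
  have : n * a = n * 1 := by
    refine le_antisymm (by rw [mul_one]; exact hle') ?_
    exact Nat.mul_le_mul_left n h1
  have ha1 : a = 1 := Nat.eq_of_mul_eq_mul_left (by omega) this
  exact_mod_cast ha1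

/-- **(M5) Equal order along a stratum keeps `F` of monomial type.** In a regular local ring `T`, if `F = v·Gⁿ` (`v` unit,
`G ∈ 𝔪_T`, `1 ≤ n`) and `iotaOrd T F ≤ n` — e.g. `T = A_𝔮` at a prime `𝔮 ∈ D(h)` with `ord_𝔮 F = ord_𝔪 F = n` given by the
stratum iff of (open″) — then `G ∉ 𝔪_T²`: `G` is a regular parameter of `T` and `F` is of monomial type in `T`
(so (open″)'s presentation in case (ii) is `(G)^m` at every stratum prime). [OURS · L1 W4.3, kernel] -/
theorem not_mem_sq_of_iotaOrd_le_of_eq_unit_mul_pow {T : Type} [CommRing T] [IsRegularLocalRing T] {v G F : T}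
    (hv : IsUnit v) (hG : G ∈ maximalIdeal T) {n : ℕ} (hn : 1 ≤ n) (hF : F = v * G ^ n)
    (hle : iotaOrd T F ≤ n) : G ∉ maximalIdeal T ^ 2 := by
  have hle' : adicOrder F ≤ n := by
    rw [iotaOrd_eq_ordOfENat_adicOrder, ← ordOfENat_natCast, ordOfENat_le_ordOfENat] at hle
    exact hle
  have h1 := adicOrder_eq_one_of_unit_mul_pow_le hv hG hn hF hle'
  rw [← adicOrder_le_iff G 1, h1]
  exact_mod_cast le_rfl

/-- (M5, packaged) Under the hypotheses of `not_mem_sq_of_iotaOrd_le_of_eq_unit_mul_pow`, `F` is of monomial type in `T` with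
the SAME `v`, `G`, `n` — the literal `∃ v g ν, IsUnit v ∧ g ∈ 𝔪 ∧ g ∉ 𝔪² ∧ F = v * g ^ ν` shape of `IsMonomialType F`
((o24-D)). [OURS · L1 W4.3, kernel] -/
theorem exists_eq_unit_mul_pow_of_iotaOrd_le {T : Type} [CommRing T] [IsRegularLocalRing T] {v G F : T}
    (hv : IsUnit v) (hG : G ∈ maximalIdeal T) {n : ℕ} (hn : 1 ≤ n) (hF : F = v * G ^ n)
    (hle : iotaOrd T F ≤ n) :
    ∃ (v' g' : T) (ν : ℕ), IsUnit v' ∧ g' ∈ maximalIdeal T ∧ g' ∉ maximalIdeal T ^ 2 ∧ F = v' * g' ^ ν :=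
  ⟨v, G, n, hv, hG, not_mem_sq_of_iotaOrd_le_of_eq_unit_mul_pow hv hG hn hF hle, hF⟩

/-- (M5, with images) The model-to-local form used by (open″): for a ring map `φ : A → T` into a regular local ring,
`F = v·Gⁿ` in `A` with `φ v` a unit, `φ G ∈ 𝔪_T`, `1 ≤ n` and `iotaOrd T (φ F) ≤ n` give: `φ G` is a regular parameter of `T`
and `φ F = φ v · (φ G)ⁿ` is of monomial type in `T`. [OURS · L1 W4.3, kernel] -/
theorem map_not_mem_sq_of_iotaOrd_le {A T : Type} [CommRing A] [CommRing T] [IsRegularLocalRing T] (φ : A →+* T)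
    {v G F : A} (hv : IsUnit (φ v)) (hG : φ G ∈ maximalIdeal T) {n : ℕ} (hn : 1 ≤ n) (hF : F = v * G ^ n)
    (hle : iotaOrd T (φ F) ≤ n) :
    φ G ∉ maximalIdeal T ^ 2 ∧ φ F = φ v * φ G ^ n := by
  have hF' : φ F = φ v * φ G ^ n := by rw [hF, map_mul, map_pow]
  exact ⟨not_mem_sq_of_iotaOrd_le_of_eq_unit_mul_pow hv hG hn hF' hle, hF'⟩

/-! ## The (strat) dichotomy of p509553 keyed by the literal `IsMonomialType` shape -/

/-- CASE B of (strat)+(adm) for `iotaOrd` (Krull dimension ≤ 2) with the hypothesis in the literal `¬ IsMonomialType f` shape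
`¬ ∃ v g ν, IsUnit v ∧ g ∈ 𝔪 ∧ g ∉ 𝔪² ∧ f = v * g ^ ν` ((o24-D)): centre `𝔪`, (strat) iff and (adm). [OURS · L1 W4.3, kernel] -/
theorem strat_adm_maximalIdeal_of_not_exists [IsRegularLocalRing S] (hdim : ringKrullDim S ≤ 2) {f : S} (hf0 : f ≠ 0)
    (hf2 : f ∈ maximalIdeal S ^ 2)
    (hB : ¬ ∃ (v g : S) (n : ℕ), IsUnit v ∧ g ∈ maximalIdeal S ∧ g ∉ maximalIdeal S ^ 2 ∧ f = v * g ^ n) :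
    (∀ (𝔭 : Ideal S) [𝔭.IsPrime], f ∈ 𝔭 →
        (iotaOrd (Localization.AtPrime 𝔭) (algebraMap S (Localization.AtPrime 𝔭) f) = iotaOrd S f ↔
          maximalIdeal S ≤ 𝔭)) ∧
      ∀ (Q : Ideal S) [Q.IsPrime], maximalIdeal S ≤ Q →
        algebraMap S (Localization.AtPrime Q) f ∈ maximalIdeal (Localization.AtPrime Q) ^ 2 := by
  push Not at hB
  obtain ⟨-, -, -, hstrat⟩ := strat_maximalIdeal_of_forall_ne hdim hf0 (Ideal.pow_le_self two_ne_zero hf2) hB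
  exact ⟨fun 𝔭 _ hf𝔭 => hstrat 𝔭 hf𝔭, fun Q _ hQ => adm_maximalIdeal hf2 Q hQ⟩

/-- CASE A of (strat)+(adm) for `iotaOrd` (ANY Krull dimension) from the literal `IsMonomialType f` witness with `f ∈ 𝔪²`:
centre `(g)`, (strat) iff and (adm). [OURS · L1 W4.3, kernel] -/
theorem strat_adm_span_singleton_of_eq_unit_mul_pow [IsRegularLocalRing S] {v g f : S} (hv : IsUnit v)
    (hg : g ∈ maximalIdeal S) (hg2 : g ∉ maximalIdeal S ^ 2) {n : ℕ} (hf : f = v * g ^ n)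
    (hf2 : f ∈ maximalIdeal S ^ 2) :
    (Ideal.span {g}).IsPrime ∧ IsRegularLocalRing (S ⧸ Ideal.span {g}) ∧ f ∈ Ideal.span {g} ∧
      (∀ (𝔭 : Ideal S) [𝔭.IsPrime], f ∈ 𝔭 →
        (iotaOrd (Localization.AtPrime 𝔭) (algebraMap S (Localization.AtPrime 𝔭) f) = iotaOrd S f ↔
          Ideal.span {g} ≤ 𝔭)) ∧
      ∀ (Q : Ideal S) [Q.IsPrime], Ideal.span {g} ≤ Q →
        algebraMap S (Localization.AtPrime Q) f ∈ maximalIdeal (Localization.AtPrime Q) ^ 2 := by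
  have hn2 : 2 ≤ n := two_le_of_eq_unit_mul_pow_of_mem_sq hv hg hg2 hf hf2
  obtain ⟨h1, h2, h3, h4⟩ := strat_of_eq_unit_mul_pow hv hg hg2 (lt_of_lt_of_le Nat.zero_lt_two hn2) hf
  exact ⟨h1, h2, h3, fun 𝔭 _ hf𝔭 => h4 𝔭 hf𝔭, fun Q _ hQ => adm_span_singleton hn2 hf Q hQ⟩

/-! ## Spreading a monomial-type relation from `A_𝔪` to a basic open neighbourhood -/

/-- **Spreading out.** If `F/1 = v·(G/1)ⁿ` in `A_𝔪` with `v` a unit, then for some `h ∉ 𝔪` and EVERY prime `𝔮 ∌ h`: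
`F/1 = w·(G/1)ⁿ` in `A_𝔮` with `w` a unit (write `v = a/s`, clear denominators: `t·s·F = t·a·Gⁿ` in `A`, `t, s, a ∉ 𝔪`;
take `h = t·s·a`). Combined with (M5) at a stratum prime this makes `F` of monomial type in `A_𝔮`. [folklore] -/
theorem exists_forall_localization_eq_unit_mul_pow {A : Type} [CommRing A] (𝔪 : Ideal A) [𝔪.IsPrime] {F G : A}
    {n : ℕ} {v : Localization.AtPrime 𝔪} (hv : IsUnit v)
    (hF : algebraMap A (Localization.AtPrime 𝔪) F = v * (algebraMap A (Localization.AtPrime 𝔪) G) ^ n) :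
    ∃ h : A, h ∉ 𝔪 ∧ ∀ (𝔮 : Ideal A) [𝔮.IsPrime], h ∉ 𝔮 →
      ∃ w : Localization.AtPrime 𝔮, IsUnit w ∧
        algebraMap A (Localization.AtPrime 𝔮) F = w * (algebraMap A (Localization.AtPrime 𝔮) G) ^ n := by
  -- `v = a/s`: `v * s/1 = a/1`
  obtain ⟨⟨a, s⟩, has⟩ := IsLocalization.surj 𝔪.primeCompl v
  -- `a ∉ 𝔪` since `a/1 = v·(s/1)` is a unit
  have ha : a ∉ 𝔪 := by
    intro ha
    have hu : IsUnit (algebraMap A (Localization.AtPrime 𝔪) a) := by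
      rw [← has]
      exact hv.mul (IsLocalization.map_units (Localization.AtPrime 𝔪) s)
    exact ((IsLocalization.AtPrime.isUnit_to_map_iff (Localization.AtPrime 𝔪) 𝔪 a).mp hu) ha
  -- the relation `s·F = a·Gⁿ` holds in `A_𝔪`, hence `t·(s·F) = t·(a·Gⁿ)` in `A` for some `t ∉ 𝔪`
  have hrel : algebraMap A (Localization.AtPrime 𝔪) ((s : A) * F) =
      algebraMap A (Localization.AtPrime 𝔪) (a * G ^ n) := by
    rw [map_mul, map_mul, map_pow, hF, ← has]
    ring
  obtain ⟨t, ht⟩ := (IsLocalization.eq_iff_exists 𝔪.primeCompl (Localization.AtPrime 𝔪)).mp hrel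
  refine ⟨(t : A) * (s : A) * a, ?_, fun 𝔮 _ h𝔮 => ?_⟩
  · intro hmem
    rcases Ideal.IsPrime.mem_or_mem ‹_› hmem with hts | ha'
    · rcases Ideal.IsPrime.mem_or_mem ‹_› hts with ht' | hs'
      · exact t.2 ht'
      · exact s.2 hs'
    · exact ha ha'
  · have ht𝔮 : (t : A) ∉ 𝔮 := fun h => h𝔮 (Ideal.mul_mem_right _ _ (Ideal.mul_mem_right _ _ h))
    have hs𝔮 : (s : A) ∉ 𝔮 := fun h => h𝔮 (Ideal.mul_mem_right _ _ (Ideal.mul_mem_left _ _ h))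
    have ha𝔮 : a ∉ 𝔮 := fun h => h𝔮 (Ideal.mul_mem_left _ _ h)
    have htu : IsUnit (algebraMap A (Localization.AtPrime 𝔮) t) :=
      IsLocalization.map_units (Localization.AtPrime 𝔮) (⟨t, ht𝔮⟩ : 𝔮.primeCompl)
    have hsu : IsUnit (algebraMap A (Localization.AtPrime 𝔮) s) :=
      IsLocalization.map_units (Localization.AtPrime 𝔮) (⟨s, hs𝔮⟩ : 𝔮.primeCompl)
    have hau : IsUnit (algebraMap A (Localization.AtPrime 𝔮) a) :=
      IsLocalization.map_units (Localization.AtPrime 𝔮) (⟨a, ha𝔮⟩ : 𝔮.primeCompl)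
    -- push the relation to `A_𝔮` and cancel `t`
    have h1 : algebraMap A (Localization.AtPrime 𝔮) s * algebraMap A (Localization.AtPrime 𝔮) F =
        algebraMap A (Localization.AtPrime 𝔮) a * (algebraMap A (Localization.AtPrime 𝔮) G) ^ n := by
      have h0 := congrArg (algebraMap A (Localization.AtPrime 𝔮)) ht
      rw [map_mul, map_mul, map_mul, map_mul, map_pow] at h0
      exact htu.mul_left_cancel h0
    refine ⟨algebraMap A (Localization.AtPrime 𝔮) a * ↑(hsu.unit⁻¹), hau.mul (Units.isUnit _), ?_⟩
    apply hsu.mul_left_cancel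
    rw [h1, ← mul_assoc, ← mul_assoc, mul_comm (algebraMap A _ (s : A)) (algebraMap A _ a), mul_assoc (algebraMap A _ a),
      IsUnit.mul_val_inv, mul_one]

end IotaOrderStrat

end Summit.ResolutionOfSingularities.ResolutionOfSingularities.Cruxes.HypersurfaceCentreConstruction.LocalEngine

end
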